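import Summits.KontsevichZagierPeriods.Zeta5Search.Barrier.ConeGammaRegularCusp

/-!
# ζ(5) search — BARRIER: `Φ` and `γ` are NOT differentiable at a direction with a non-zero cusp slope

HONEST FRAMING (cell `pub-zeta5`): systematic search; no irrationality claim unless kernel-certified. MODEL objects
under Brown–Zudilin's (28)+(30) accounting ([BZ22] = arXiv:2210.03391; (28) observed, not proved); statements about
the MODEL saving rate `phi30` and the sSup-form rate function `gamma` of `ConeGammaRates` at directions where the named
slope `cuspSlope` of `ConeGammaLogCuspSlope` is non-zero; nothing here asserts the SIGN or size of any cusp slope at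
any direction, anything about the cone's supremum (C2 = `BarrierC2`, OPEN), S-E (CONJECTURED) or `ζ(5)`. No number or
sentence of record moves. Records in print UNMOVED. Prover P2 g23 (self-selected Lean-only item «BZ's cubic (20) in
the kernel», file 8: the READING «such a direction is NOT a point of differentiability» of `ConeGammaLogCuspGamma` /
SE-STRUCTURE §3 Cor. 1, as theorems).

* `not_differentiableAt_of_diffQuot_tendsto_atTop` / `_atBot` — (pure calculus on `Dir = ℝ⁸`) if along some line
  `ε ↦ a + ε·v` the one-sided difference quotient of `f` tends to `+∞` (or `−∞`) as `ε → 0⁺`, then `f` is not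
  (Fréchet-)differentiable at `a`;
* **`not_differentiableAt_phi30_of_cuspSlope_ne_zero`** — on the open box, for a period `T` and a displacement `δ`
  with `cuspSlope a T δ ≠ 0`: `Φ = phi30` is NOT differentiable at `a` (P2 g19's `phi30_diffQuot_tendsto_cuspSlope`);
* **`not_differentiableAt_gamma_of_cuspSlope_ne_zero`** — at a Regular open-box direction with `Q = C₁ + δ₂₈ − Φ > 0`,
  for a period `T` and a displacement `δ` with `cuspSlope a T δ ≠ 0`: `γ` is NOT differentiable at `a`
  (`ConeGammaRegularCusp.gamma_diffQuot_tendsto_of_regular`).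
-/

noncomputable section

open Set Metric Filter
open scoped Topology

namespace Summit.KontsevichZagierPeriods.Zeta5Search.Barrier.ConeGamma

/-- The one-sided difference quotient of a differentiable function along a line has a finite limit. -/
theorem tendsto_diffQuot_of_differentiableAt {f : Dir → ℝ} {a : Dir} (hd : DifferentiableAt ℝ f a) (v : Dir) :
    Tendsto (fun ε : ℝ => (f (a + ε • v) - f a) / ε) (𝓝[>] 0) (𝓝 (fderiv ℝ f a v)) := by
  have hline : HasDerivAt (fun ε : ℝ => a + ε • v) v 0 := by
    simpa using ((hasDerivAt_id (0 : ℝ)).smul_const v).const_add a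
  have h0 : a + (0 : ℝ) • v = a := by simp
  have hF : HasFDerivAt f (fderiv ℝ f a) (a + (0 : ℝ) • v) := by rw [h0]; exact hd.hasFDerivAt
  have hcomp : HasDerivAt (fun ε : ℝ => f (a + ε • v)) (fderiv ℝ f a v) 0 := hF.comp_hasDerivAt (0 : ℝ) hline
  have ht := hasDerivAt_iff_tendsto_slope_zero.mp hcomp
  have ht' : Tendsto (fun t : ℝ => t⁻¹ • (f (a + (0 + t) • v) - f (a + (0 : ℝ) • v))) (𝓝[>] 0)
      (𝓝 (fderiv ℝ f a v)) :=
    ht.mono_left (nhdsWithin_mono _ fun x hx => ne_of_gt hx)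
  refine ht'.congr' ?_
  filter_upwards [self_mem_nhdsWithin] with t _
  simp only [zero_add, zero_smul, add_zero, smul_eq_mul]
  ring

/-- **No derivative where a one-sided difference quotient blows up (`+∞`).** -/
theorem not_differentiableAt_of_diffQuot_tendsto_atTop {f : Dir → ℝ} {a v : Dir}
    (h : Tendsto (fun ε : ℝ => (f (a + ε • v) - f a) / ε) (𝓝[>] 0) atTop) : ¬ DifferentiableAt ℝ f a :=
  fun hd => not_tendsto_nhds_of_tendsto_atTop h _ (tendsto_diffQuot_of_differentiableAt hd v)

/-- **No derivative where a one-sided difference quotient blows up (`−∞`).** -/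
theorem not_differentiableAt_of_diffQuot_tendsto_atBot {f : Dir → ℝ} {a v : Dir}
    (h : Tendsto (fun ε : ℝ => (f (a + ε • v) - f a) / ε) (𝓝[>] 0) atBot) : ¬ DifferentiableAt ℝ f a :=
  fun hd => not_tendsto_nhds_of_tendsto_atBot h _ (tendsto_diffQuot_of_differentiableAt hd v)

/-- **`Φ` IS NOT DIFFERENTIABLE at an open-box direction with a non-zero cusp slope** (for some period `T` of the
forms and some displacement `δ`). -/
theorem not_differentiableAt_phi30_of_cuspSlope_ne_zero {a : Dir}
    (hopen : ∀ j : Fin 7, 0 < sParam a j.succ ∧ sParam a j.succ < sParam a 0)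
    {T : ℝ} (hT : 0 < T) (hper : ∀ k : Fin 28, ∃ z : ℤ, T * h28 a k = z) {δ : Fin 8 → ℝ}
    (hσ : cuspSlope a T δ ≠ 0) : ¬ DifferentiableAt ℝ phi30 a := by
  obtain ⟨hup, hdown⟩ := phi30_diffQuot_tendsto_cuspSlope hopen hT hper δ
  have e : (fun ε : ℝ => (phi30 (aOfS (sParam a + ε • δ)) - phi30 a) / ε)
      = fun ε : ℝ => (phi30 (a + ε • aOfS δ) - phi30 a) / ε := by
    funext ε; rw [aOfS_sParam_add_smul]
  rcases lt_or_gt_of_ne hσ with hneg | hpos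
  · have h := hdown hneg
    rw [e] at h
    exact not_differentiableAt_of_diffQuot_tendsto_atBot h
  · have h := hup hpos
    rw [e] at h
    exact not_differentiableAt_of_diffQuot_tendsto_atTop h

/-- **`γ` IS NOT DIFFERENTIABLE at a Regular open-box direction (`Q > 0`) with a non-zero cusp slope** (for some
period `T` of the forms and some displacement `δ`). -/
theorem not_differentiableAt_gamma_of_cuspSlope_ne_zero {a : Dir}
    (hopen : ∀ j : Fin 7, 0 < sParam a j.succ ∧ sParam a j.succ < sParam a 0)
    {T : ℝ} (hT : 0 < T) (hper : ∀ k : Fin 28, ∃ z : ℤ, T * h28 a k = z) {δ : Fin 8 → ℝ}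
    (hQ : 0 < C1 a + delta28 a - phi30 a) (hreg : Regular a) (hσ : cuspSlope a T δ ≠ 0) :
    ¬ DifferentiableAt ℝ gamma a := by
  obtain ⟨hup, hdown⟩ := gamma_diffQuot_tendsto_of_regular hopen hT hper δ hQ hreg
  have e : (fun ε : ℝ => (gamma (aOfS (sParam a + ε • δ)) - gamma a) / ε)
      = fun ε : ℝ => (gamma (a + ε • aOfS δ) - gamma a) / ε := by
    funext ε; rw [aOfS_sParam_add_smul]
  rcases lt_or_gt_of_ne hσ with hneg | hpos
  · have h := hdown hneg
    rw [e] at h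
    exact not_differentiableAt_of_diffQuot_tendsto_atBot h
  · have h := hup hpos
    rw [e] at h
    exact not_differentiableAt_of_diffQuot_tendsto_atTop h

end Summit.KontsevichZagierPeriods.Zeta5Search.Barrier.ConeGamma

end
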